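import Summits.BirchSwinnertonDyer.BirchSwinnertonDyer.Theses.PrintCf2
import Summits.BirchSwinnertonDyer.Rank1Residual.P2.KrizLiSmallCMBaseTransport
import HarnessLib

/-!
# Route PrintCf2 — aside item `InertKrizLiStarDoorOfFactsPlus` (stmt-21366) CLOSED

Cell `bsd-print-cf2` (D-0131 (2) PRINT TIER, leaf CornerF @ `p = 2`), prover p3 g3. The aside is the
KRIZ–LI (★)-DOOR IN GENERIC FORM (planner g4, route rev 14; lit DOSSIER §14.6): granted 𝔅_inert (the eight
facts of `InertTwoRankOneOfFacts`, VERBATIM) ∧ Kriz–Li 2019 Thm 4.3 (`KrizLi2019.thm33_rank_twist`) ∧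
Creutz–Miller 2012 / Miller–Stoll 2013 (`bsdTriple_of_analyticRank_le_one_of_conductor_lt`), every globally
minimal CM curve `W` of analytic rank one with `2` inert in `K_CM`, `ℚ`-ISOGENOUS to `E^{(d)}` or
`E^{(d·d_K″)}` for SOME globally minimal CM base `E` with `N_E < 5000`, `r_an(E) = 1`, `E(ℚ)[2] = 0`, SOME
imaginary quadratic `K″` with the Heegner hypothesis, SOME parametrisation datum / Heegner datum / embedding /
Heegner point / `j : K″ → ℚ₂` with Assumption (★), `c₂(E)` odd (and `Dt.c` odd if additive at `2`), and
SOME `d ∈ 𝒩(E, K″)` with `χ_d(−N_E) = 1`, satisfies `BSD(W, 2)`. Proof: destructure the bundle and the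
membership package and apply the base- and field-generic transport
`P2.bsdp_two_of_isIsogenous_twist_of_krizLi_cmBase` (p555698), which needs exactly Kriz–Li Thm 5.1 (2)
(conjunct 5), Thm 4.3, Creutz–Miller, Burungale–Flach (4), modularity (2), GZK (1), Cassels (3); the
package's `r_an(E) = 1` gives the transport's `1 ≤ rank_ℤ E(ℚ)` by GZK. Currency: LITERAL-by-name((★)
inside the membership) for certified pairs, print for `(243a1, ℚ(√−23))`. beyond-print: NO as a method.
[cite: KrizLi2019, Thm. 5.1 (2), Thm. 4.3, §6 Ex. 6.2, Table 1 and Rem. 6.3] [cite: CreutzMiller2012, Thm. 1.1]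
[cite: BurungaleFlach2024, Thm. 1.1 and Cor. 2] [cite: MilneADT2006, Thm. I.7.3]
-/

-- single-conjunct summit: `Summit.BirchSwinnertonDyer.BirchSwinnertonDyer.…` repeats the name by design
set_option linter.dupNamespace false

open WeierstrassCurve Literature.NumberTheory.EllipticCurves Summit.BirchSwinnertonDyer.Rank1Residual

namespace Summit.BirchSwinnertonDyer.BirchSwinnertonDyer.Theorems

/-- **Item `InertKrizLiStarDoorOfFactsPlus` holds**: 𝔅_inert ∧ Thm 4.3 ∧ Creutz–Miller ⟹ the generic
Kriz–Li (★)-door on the inert type, by `P2.bsdp_two_of_isIsogenous_twist_of_krizLi_cmBase`.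
[cite: KrizLi2019, Thm. 5.1 (2) and Thm. 4.3] [cite: CreutzMiller2012, Thm. 1.1]
[cite: BurungaleFlach2024, Thm. 1.1 and Cor. 2] [cite: MilneADT2006, Thm. I.7.3] -/
theorem inertKrizLiStarDoorOfFactsPlus_proof :
    Summit.BirchSwinnertonDyer.BirchSwinnertonDyer.Theses.PrintCf2.InertKrizLiStarDoorOfFactsPlus := by
  unfold Summit.BirchSwinnertonDyer.BirchSwinnertonDyer.Theses.PrintCf2.InertKrizLiStarDoorOfFactsPlus
  rintro ⟨⟨hGZK, hmod, hCas, hBF, hKL, _, _, _⟩, h33, hS31⟩ W _ _ _ _ _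
    ⟨E, _, _, _, K, _, _, Dt, H, ι, P, j, d, hcm, hN, hr1, h2, hK, hH, hP, hstar, hloc, hd, hsign, hiso⟩
  have hrk : 1 ≤ E.mordellWeilRank := by
    have h := (hGZK E hr1.le).1
    omega
  exact P2.bsdp_two_of_isIsogenous_twist_of_krizLi_cmBase E hKL h33 hS31 hBF hmod hGZK hCas hcm hN hrk h2 K
    hK hH Dt H ι P hP j hstar hloc hd hsign W hiso

end Summit.BirchSwinnertonDyer.BirchSwinnertonDyer.Theorems
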